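import Mathlib
import Summits.NavierStokesRegularity.NavierStokesRegularity.Theorems.SubOnsagerCeilingSideBranchParkingHorizon
import Summits.NavierStokesRegularity.NavierStokesRegularity.Theorems.SubOnsagerCeilingSideBranchOccupationReduction
import HarnessLib

/-!
# Route SubOnsagerCeiling — the FOURTH-MOMENT OCCUPATION BOUND ON HORIZONS refutes the aside cruxes
# (operative reduction, def-free; helper file for item stmt-NavierStokesRegularity-25507 `OrthantTailCeiling`; `--supports`)

ERRATUM AND OPERATIVE FORM for `…SideBranchOccupationReduction.lean` (p827036).  There the occupation bound
was asked on EVERY window `[0,s]`, `s > 0`, at a viscosity threshold depending on the depth only; because of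
the viscous factor `e^{ν_{j+1}t}` in the capture law, that hypothesis cannot hold for a fixed `ν > 0` as
`t → ∞` (it is vacuous as a target).  The reduction never needed it beyond the block-relaxation horizon.  The
OPERATIVE target is the bound ON HORIZONS: for every depth `K` and horizon `T > 0` a threshold
`ν₀ = ν₀(K,T)` such that, along every regular `ν`-viscous solution (`0 < ν ≤ ν₀`) of `α_SB` on any `[0,s]`
with `s ≤ T` from the chain datum, non-negative on the shells `≥ 1` and obeying the `(θ, C)` ceiling,

  `Σ_{j<K} ½·(4e^{ν_{j+1}t}(Λ_j/5)∫₀ᵗ x_j⁴)^{2/3} ≤ (1 − q)·E₀`   for all `t ∈ [0,s]`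

(here `e^{ν_{j+1}t} ≤ e^{ν₀(1+ε₀)^{2K}T}` is harmless).  This is a sub-Kolmogorov bound on the time-integrated
fourth moments of the CHAIN modes only — brief fronts, weak wake — uniform in small viscosity on bounded
horizons; numerically the self-similar Kolmogorov wake has `Λ_j∫x_j⁴ ≍ Λ_j^{-1/3}` (Barbato–Flandoli–Morandin
2011), while the best rigorous pointwise bound (Barbato–Morandin 2013) only gives `Λ_j^{+1/5}` at `b = 2`.

* **`sideBranchCeilingEscapeAt_of_occupationBoundOnHorizons`** — OCCUPATION BOUND ON HORIZONS (`q`)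
  `⇒ SideBranchCeilingEscapeAt ε₀` (pockets below occupation terms by `sideBranch_pocket_sq_le_occupation`,
  datum pocket empty, then `sideBranchCeilingEscapeAt_of_parkingBoundOnHorizons`);
* `orthantTailCeiling_false_of_occupationBoundOnHorizons`, `forwardTailCeiling_false_of_occupationBoundOnHorizons`
  — the aside cruxes stmt-25507 / stmt-26608 BY NAME modulo it.

HONEST FRAMING: MODEL lattice ODEs only (Tao 2016 §4 vocabulary; rung TL-M2Break); a reduction between
unproved statements; settles nothing by itself; nothing here is a statement about the Navier–Stokes equations.
[cite: Tao2016AveragedNS, §4 (4.2)–(4.3), (4.5)]; Katz–Pavlović couplings: [cite: BarbatoMorandinRomito2011, §2].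
-/

noncomputable section

-- the sub-problem namespace `NavierStokesRegularity.NavierStokesRegularity` is the tree's layout (D-0017)
set_option linter.dupNamespace false

namespace Summit.NavierStokesRegularity.NavierStokesRegularity.Theorems.SubOnsagerCeiling

open Set Filter MeasureTheory intervalIntegral
open scoped Topology
open Literature.Analysis.FluidPDE.TaoCascade
open Summit.NavierStokesRegularity.NavierStokesRegularity.Theses.SubOnsagerCeiling

/-- **FOURTH-MOMENT OCCUPATION BOUND ON HORIZONS `→ SideBranchCeilingEscapeAt ε₀`** (the operative form;
hypothesis inline: `q > 0`; for every `(θ, C)` a chain datum `X₀` (`X₀ 0 ≥ 0`, `X₀ 1 = X₀ 2 = X₀ 3 = 0`,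
`E₀ > 0`); for every depth `K` and horizon `T > 0` a threshold `ν₀ > 0`; for all `0 < ν ≤ ν₀`, all
`0 < s ≤ T` and every regular `ν`-viscous solution of `α_SB` on `[0,s]` from `X₀`, non-negative on the shells
`≥ 1` and obeying the `(θ, C)` tail ceiling: `Σ_{j<K} ½(4e^{ν_{j+1}t}(Λ_j/5)∫₀ᵗx_j⁴)^{2/3} ≤ (1−q)E₀` for all
`t ∈ [0,s]`).  MODEL lattice only; a reduction between unproved statements. [this file] -/
theorem sideBranchCeilingEscapeAt_of_occupationBoundOnHorizons {ε₀ q : ℝ} (hε : 0 < ε₀) (hq : 0 < q)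
    (h : ∀ θ : ℝ, 1 / 2 < θ → ∀ C : ℝ, 0 ≤ C →
      ∃ X₀ : Fin 4 → ℝ, 0 ≤ X₀ 0 ∧ X₀ 1 = 0 ∧ X₀ 2 = 0 ∧ X₀ 3 = 0 ∧
      0 < (∑ i : Fin 4, (1 / 2 : ℝ) * X₀ i ^ 2) ∧
      ∀ K : ℕ, ∀ T : ℝ, 0 < T → ∃ ν₀ : ℝ, 0 < ν₀ ∧ ∀ ν : ℝ, 0 < ν → ν ≤ ν₀ →
      ∀ s : ℝ, 0 < s → s ≤ T →
      ∀ X : Fin 4 → ℤ → ℝ → ℝ,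
      (∀ (i : Fin 4) (k : ℤ), X i k 0 = if k = 0 then X₀ i else 0) →
      (∀ (i : Fin 4) (k : ℤ), k < 0 → ∀ t : ℝ, X i k t = 0) →
      (∃ M : ℝ, ∀ (t : ℝ) (i : Fin 4) (k : ℤ), (1 + (1 + ε₀) ^ ((10 : ℝ) * k)) * |X i k t| ≤ M) →
      (∀ (i : Fin 4) (k : ℤ), Continuous (X i k)) →
      (∀ (i : Fin 4) (k : ℤ), ∀ t ∈ Set.Icc (0 : ℝ) s, HasDerivWithinAt (X i k)
      (quadTerm ε₀ sideBranchTable X i k t - ν * (1 + ε₀) ^ ((2 : ℝ) * k) * X i k t)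
      (Set.Icc (0 : ℝ) s) t) →
      (∀ t ∈ Set.Icc (0 : ℝ) s, ∀ (i : Fin 4) (k : ℤ), 1 ≤ k → 0 ≤ X i k t) →
      (∀ n N : ℕ, n ≤ N → ∀ u ∈ Set.Icc (0 : ℝ) s,
      ∑ k ∈ Finset.Icc n N, ∑ i : Fin 4, (1 / 2 : ℝ) * X i (k : ℤ) u ^ 2 ≤
      C * (∑ i : Fin 4, (1 / 2 : ℝ) * X₀ i ^ 2) * (1 + ε₀) ^ (-(2 * θ * (n : ℝ)))) →
      ∀ t ∈ Set.Icc (0 : ℝ) s,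
      (∑ j ∈ Finset.range K, (1 / 2 : ℝ) *
        (4 * Real.exp (ν * (1 + ε₀) ^ ((2 : ℝ) * (((j : ℤ) + 1 : ℤ) : ℝ)) * t) *
          ((1 / 5 : ℝ) * (1 + ε₀) ^ ((5 : ℝ) * ((j : ℤ) : ℝ) / 2) *
            ∫ u in (0 : ℝ)..t, X 0 (j : ℤ) u ^ 4)) ^ ((2 : ℝ) / 3)) ≤
      (1 - q) * (∑ i : Fin 4, (1 / 2 : ℝ) * X₀ i ^ 2)) :
    SideBranchCeilingEscapeAt ε₀ := by
  refine sideBranchCeilingEscapeAt_of_parkingBoundOnHorizons hε hq fun θ hθ C hC => ?_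
  obtain ⟨X₀, hX0, hX1, hX2, hX3, hE₀, hK⟩ := h θ hθ C hC
  refine ⟨X₀, hX0, hX1.symm.le, hX2.symm.le, hX3, hE₀, fun K T hT => ?_⟩
  obtain ⟨ν₀, hν₀, hocc⟩ := hK K T hT
  refine ⟨ν₀, hν₀, fun ν hν hνle s hs hsT X hinit hlow hbd hcont hder hpos hceil t ht => ?_⟩
  have hocc' := hocc ν hν hνle s hs hsT X hinit hlow hbd hcont hder hpos hceil t ht
  -- pocket `0` is empty, pocket `j+1` is below the `j`-th occupation term
  have hz0 : X 2 0 t = 0 :=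
    sideBranch_pocket_zero_eq_zero hlow hder (by rw [hinit 2 0]; simp [hX2]) ht
  have hstep : ∀ j ∈ Finset.range K, (1 / 2 : ℝ) * X 2 (((j + 1 : ℕ) : ℤ)) t ^ 2 ≤
      (1 / 2 : ℝ) * (4 * Real.exp (ν * (1 + ε₀) ^ ((2 : ℝ) * (((j : ℤ) + 1 : ℤ) : ℝ)) * t) *
        ((1 / 5 : ℝ) * (1 + ε₀) ^ ((5 : ℝ) * ((j : ℤ) : ℝ) / 2) *
          ∫ u in (0 : ℝ)..t, X 0 (j : ℤ) u ^ 4)) ^ ((2 : ℝ) / 3) := by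
    intro j _
    have hs0 : X 1 (j : ℤ) 0 = 0 := by
      rw [hinit 1 (j : ℤ)]; by_cases hj : (j : ℤ) = 0 <;> simp [hj, hX1]
    have hz00 : X 2 ((j : ℤ) + 1) 0 = 0 := by
      rw [hinit 2 ((j : ℤ) + 1)]
      have : ((j : ℤ) + 1) ≠ 0 := by omega
      simp [this]
    have h1 := sideBranch_pocket_sq_le_occupation hε hν.le hcont hder (j : ℤ) hs0 hz00 ht
    push_cast at h1 ⊢
    linarith
  rw [Finset.sum_range_succ', Nat.cast_zero, hz0]
  simp only [ne_eq, OfNat.ofNat_ne_zero, not_false_eq_true, zero_pow, mul_zero, add_zero]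
  exact (Finset.sum_le_sum hstep).trans hocc'

/-- **`OrthantTailCeiling` (stmt-25507) BY NAME modulo the fourth-moment occupation bound ON HORIZONS at
some `ε₀ ∈ (0,1]`** (hypothesis inline, shape of `sideBranchCeilingEscapeAt_of_occupationBoundOnHorizons`).
MODEL lattice only; conditional; settles nothing by itself. [this file] -/
theorem orthantTailCeiling_false_of_occupationBoundOnHorizons
    (h : ∃ ε₀ : ℝ, 0 < ε₀ ∧ ε₀ ≤ 1 ∧ ∃ q : ℝ, 0 < q ∧
      ∀ θ : ℝ, 1 / 2 < θ → ∀ C : ℝ, 0 ≤ C →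
      ∃ X₀ : Fin 4 → ℝ, 0 ≤ X₀ 0 ∧ X₀ 1 = 0 ∧ X₀ 2 = 0 ∧ X₀ 3 = 0 ∧
      0 < (∑ i : Fin 4, (1 / 2 : ℝ) * X₀ i ^ 2) ∧
      ∀ K : ℕ, ∀ T : ℝ, 0 < T → ∃ ν₀ : ℝ, 0 < ν₀ ∧ ∀ ν : ℝ, 0 < ν → ν ≤ ν₀ →
      ∀ s : ℝ, 0 < s → s ≤ T →
      ∀ X : Fin 4 → ℤ → ℝ → ℝ,
      (∀ (i : Fin 4) (k : ℤ), X i k 0 = if k = 0 then X₀ i else 0) →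
      (∀ (i : Fin 4) (k : ℤ), k < 0 → ∀ t : ℝ, X i k t = 0) →
      (∃ M : ℝ, ∀ (t : ℝ) (i : Fin 4) (k : ℤ), (1 + (1 + ε₀) ^ ((10 : ℝ) * k)) * |X i k t| ≤ M) →
      (∀ (i : Fin 4) (k : ℤ), Continuous (X i k)) →
      (∀ (i : Fin 4) (k : ℤ), ∀ t ∈ Set.Icc (0 : ℝ) s, HasDerivWithinAt (X i k)
      (quadTerm ε₀ sideBranchTable X i k t - ν * (1 + ε₀) ^ ((2 : ℝ) * k) * X i k t)
      (Set.Icc (0 : ℝ) s) t) →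
      (∀ t ∈ Set.Icc (0 : ℝ) s, ∀ (i : Fin 4) (k : ℤ), 1 ≤ k → 0 ≤ X i k t) →
      (∀ n N : ℕ, n ≤ N → ∀ u ∈ Set.Icc (0 : ℝ) s,
      ∑ k ∈ Finset.Icc n N, ∑ i : Fin 4, (1 / 2 : ℝ) * X i (k : ℤ) u ^ 2 ≤
      C * (∑ i : Fin 4, (1 / 2 : ℝ) * X₀ i ^ 2) * (1 + ε₀) ^ (-(2 * θ * (n : ℝ)))) →
      ∀ t ∈ Set.Icc (0 : ℝ) s,
      (∑ j ∈ Finset.range K, (1 / 2 : ℝ) *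
        (4 * Real.exp (ν * (1 + ε₀) ^ ((2 : ℝ) * (((j : ℤ) + 1 : ℤ) : ℝ)) * t) *
          ((1 / 5 : ℝ) * (1 + ε₀) ^ ((5 : ℝ) * ((j : ℤ) : ℝ) / 2) *
            ∫ u in (0 : ℝ)..t, X 0 (j : ℤ) u ^ 4)) ^ ((2 : ℝ) / 3)) ≤
      (1 - q) * (∑ i : Fin 4, (1 / 2 : ℝ) * X₀ i ^ 2)) :
    ¬ OrthantTailCeiling := by
  obtain ⟨ε₀, hε, hε1, q, hq, hocc⟩ := h
  exact orthantTailCeiling_false_of_sideBranchCeilingEscape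
    ⟨ε₀, hε, hε1, sideBranchCeilingEscapeAt_of_occupationBoundOnHorizons hε hq hocc⟩

/-- **`ForwardTailCeiling` (stmt-26608) BY NAME modulo the fourth-moment occupation bound ON HORIZONS at
some `ε₀ ∈ (0,1]`** (twin reduction of record).  MODEL lattice only; conditional; settles nothing by itself.
[this file] -/
theorem forwardTailCeiling_false_of_occupationBoundOnHorizons
    (h : ∃ ε₀ : ℝ, 0 < ε₀ ∧ ε₀ ≤ 1 ∧ ∃ q : ℝ, 0 < q ∧
      ∀ θ : ℝ, 1 / 2 < θ → ∀ C : ℝ, 0 ≤ C →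
      ∃ X₀ : Fin 4 → ℝ, 0 ≤ X₀ 0 ∧ X₀ 1 = 0 ∧ X₀ 2 = 0 ∧ X₀ 3 = 0 ∧
      0 < (∑ i : Fin 4, (1 / 2 : ℝ) * X₀ i ^ 2) ∧
      ∀ K : ℕ, ∀ T : ℝ, 0 < T → ∃ ν₀ : ℝ, 0 < ν₀ ∧ ∀ ν : ℝ, 0 < ν → ν ≤ ν₀ →
      ∀ s : ℝ, 0 < s → s ≤ T →
      ∀ X : Fin 4 → ℤ → ℝ → ℝ,
      (∀ (i : Fin 4) (k : ℤ), X i k 0 = if k = 0 then X₀ i else 0) →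
      (∀ (i : Fin 4) (k : ℤ), k < 0 → ∀ t : ℝ, X i k t = 0) →
      (∃ M : ℝ, ∀ (t : ℝ) (i : Fin 4) (k : ℤ), (1 + (1 + ε₀) ^ ((10 : ℝ) * k)) * |X i k t| ≤ M) →
      (∀ (i : Fin 4) (k : ℤ), Continuous (X i k)) →
      (∀ (i : Fin 4) (k : ℤ), ∀ t ∈ Set.Icc (0 : ℝ) s, HasDerivWithinAt (X i k)
      (quadTerm ε₀ sideBranchTable X i k t - ν * (1 + ε₀) ^ ((2 : ℝ) * k) * X i k t)
      (Set.Icc (0 : ℝ) s) t) →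
      (∀ t ∈ Set.Icc (0 : ℝ) s, ∀ (i : Fin 4) (k : ℤ), 1 ≤ k → 0 ≤ X i k t) →
      (∀ n N : ℕ, n ≤ N → ∀ u ∈ Set.Icc (0 : ℝ) s,
      ∑ k ∈ Finset.Icc n N, ∑ i : Fin 4, (1 / 2 : ℝ) * X i (k : ℤ) u ^ 2 ≤
      C * (∑ i : Fin 4, (1 / 2 : ℝ) * X₀ i ^ 2) * (1 + ε₀) ^ (-(2 * θ * (n : ℝ)))) →
      ∀ t ∈ Set.Icc (0 : ℝ) s,
      (∑ j ∈ Finset.range K, (1 / 2 : ℝ) *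
        (4 * Real.exp (ν * (1 + ε₀) ^ ((2 : ℝ) * (((j : ℤ) + 1 : ℤ) : ℝ)) * t) *
          ((1 / 5 : ℝ) * (1 + ε₀) ^ ((5 : ℝ) * ((j : ℤ) : ℝ) / 2) *
            ∫ u in (0 : ℝ)..t, X 0 (j : ℤ) u ^ 4)) ^ ((2 : ℝ) / 3)) ≤
      (1 - q) * (∑ i : Fin 4, (1 / 2 : ℝ) * X₀ i ^ 2)) :
    ¬ ForwardTailCeiling := by
  obtain ⟨ε₀, hε, hε1, q, hq, hocc⟩ := h
  exact forwardTailCeiling_false_of_sideBranchCeilingEscape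
    ⟨ε₀, hε, hε1, sideBranchCeilingEscapeAt_of_occupationBoundOnHorizons hε hq hocc⟩

end Summit.NavierStokesRegularity.NavierStokesRegularity.Theorems.SubOnsagerCeiling

end
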